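import Mathlib
import HarnessLib
import Summits.Ventures.LatticeQCDFlow.Scaling.CharFunTaylorBound

/-!
# LatticeQCDFlow / Scaling — the central limit theorem for rows of INDEPENDENT, NON-IDENTICAL bounded
# blocks: `V^{-1/2} Σᵢ h_{V,i}(yᵢ) ⇒ N(0, σ²)` on `(Fin V → Y, ⊗ᵢ ρ_{V,i})` when `V⁻¹Σᵢ Var h_{V,i} → σ²`

HONEST FRAMING: exact (Metropolis-corrected) sampling algorithms for lattice gauge theory;
figures of merit are autocorrelation/cost numbers at stated couplings and volumes; no
continuum-physics claim.

Venture `LatticeQCDFlow` (cell pub-lqcd), topic `Scaling`; FANOUT row 3 (`s0-u1-a`, S0-B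
implementation A, GEN-19).  NEW WORK of the cell (Lyapunov's central limit theorem for triangular
arrays of rows of independent, NOT identically distributed, uniformly bounded summands — Mathlib has
the i.i.d. theorem only; route: row 3's third-order characteristic-function bound
`Scaling/CharFunTaylorBound`, the product lemma `∏ᵢ(1 + zᵢ) → e^{L}` when `Σzᵢ → L`, `Σ|zᵢ|² → 0`
(Mathlib's `Complex.norm_log_one_add_sub_self_le`), and Lévy's theorem); NO definition is
introduced; nothing is cited.  Reading for the cell: a factorised flow whose blocks differ from site
to site (boundary plaquettes, anisotropic couplings, mixed block types) has the same Gaussian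
log-weight limit as a homogeneous one — only the AVERAGE block variance enters
(`Scaling/HeterogeneousUniversality` draws the acceptance consequence).

## Content (all `[ours]`)

* §1 **`tendsto_finprod_one_add_cexp`** — `z_{V,i} ∈ ℂ` (`i < V`) with `Σᵢ z_{V,i} → L`,
  `Σᵢ ‖z_{V,i}‖² → 0`, eventually `‖z_{V,i}‖ ≤ 1/2` ⇒ `∏ᵢ (1 + z_{V,i}) → e^{L}`; the real version
  `tendsto_finprod_one_add_rexp`;
* §2 `heteroPi_map_comp_eval`, **`heteroPi_charFun_inv_sqrt_mul_sum`** — the characteristic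
  function of the normalised row sum is the product of the block characteristic functions;
* §3 **`heteroPi_tendstoInDistribution`** — THE THEOREM.

NOT CLAIMED: unbounded summands (Lindeberg); dependent blocks; rates.
-/

noncomputable section

namespace Summit.Ventures.LatticeQCDFlow.Theory2

open MeasureTheory ProbabilityTheory Filter Finset Real Set Complex
open scoped Topology NNReal

/-! ## §1 Products of `1 + zᵢ` with small `zᵢ` -/

section Products

/-- **`∏ᵢ (1 + z_{V,i}) → e^{L}`** when `Σᵢ z_{V,i} → L`, `Σᵢ ‖z_{V,i}‖² → 0` and eventually all
`‖z_{V,i}‖ ≤ 1/2`. [ours] -/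
theorem tendsto_finprod_one_add_cexp {z : (V : ℕ) → Fin V → ℂ} {L : ℂ}
    (hsum : Tendsto (fun V => ∑ i, z V i) atTop (𝓝 L))
    (hsq : Tendsto (fun V => ∑ i, ‖z V i‖ ^ 2) atTop (𝓝 0))
    (hsmall : ∀ᶠ V in atTop, ∀ i : Fin V, ‖z V i‖ ≤ 1 / 2) :
    Tendsto (fun V => ∏ i, (1 + z V i)) atTop (𝓝 (Complex.exp L)) := by
  -- the exponent `Σ log(1 + zᵢ) = Σ zᵢ + Σ (log(1 + zᵢ) − zᵢ)`, error `≤ Σ ‖zᵢ‖²`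
  have herr : Tendsto (fun V => ∑ i, (Complex.log (1 + z V i) - z V i)) atTop (𝓝 0) := by
    rw [tendsto_zero_iff_norm_tendsto_zero]
    refine squeeze_zero' (Filter.Eventually.of_forall fun V => norm_nonneg _) ?_ hsq
    filter_upwards [hsmall] with V hV
    refine (norm_sum_le _ _).trans (Finset.sum_le_sum fun i _ => ?_)
    have hz : ‖z V i‖ < 1 := (hV i).trans_lt (by norm_num)
    refine (Complex.norm_log_one_add_sub_self_le hz).trans ?_
    have h1 : (1 - ‖z V i‖)⁻¹ ≤ 2 := by
      rw [inv_le_comm₀ (by linarith [hV i]) (by norm_num)]; linarith [hV i]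
    calc ‖z V i‖ ^ 2 * (1 - ‖z V i‖)⁻¹ / 2 ≤ ‖z V i‖ ^ 2 * 2 / 2 := by
          gcongr
      _ = ‖z V i‖ ^ 2 := by ring
  have hexp : Tendsto (fun V => ∑ i, Complex.log (1 + z V i)) atTop (𝓝 L) := by
    have := hsum.add herr
    simp only [add_zero] at this
    refine this.congr' (Filter.Eventually.of_forall fun V => ?_)
    rw [← Finset.sum_add_distrib]
    exact Finset.sum_congr rfl fun i _ => by ring
  have hprod := (Complex.continuous_exp.tendsto L).comp hexp
  refine hprod.congr' ?_
  filter_upwards [hsmall] with V hV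
  simp only [Function.comp_apply]
  rw [Complex.exp_sum]
  refine Finset.prod_congr rfl fun i _ => Complex.exp_log ?_
  intro h0
  have : ‖z V i‖ = 1 := by
    have : z V i = -1 := by linear_combination h0
    rw [this, norm_neg, norm_one]
  linarith [hV i]

/-- The real version: `mᵢ ∈ ℝ`, `Σ mᵢ → L`, `Σ mᵢ² → 0`, eventually `|mᵢ| ≤ 1/2` ⇒
`∏ᵢ (1 + mᵢ) → e^{L}`. [ours] -/
theorem tendsto_finprod_one_add_rexp {m : (V : ℕ) → Fin V → ℝ} {L : ℝ}
    (hsum : Tendsto (fun V => ∑ i, m V i) atTop (𝓝 L))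
    (hsq : Tendsto (fun V => ∑ i, m V i ^ 2) atTop (𝓝 0))
    (hsmall : ∀ᶠ V in atTop, ∀ i : Fin V, |m V i| ≤ 1 / 2) :
    Tendsto (fun V => ∏ i, (1 + m V i)) atTop (𝓝 (Real.exp L)) := by
  have hC := tendsto_finprod_one_add_cexp (z := fun V i => (m V i : ℂ)) (L := (L : ℂ))
    (by simpa [Function.comp_def, Complex.ofReal_sum] using (Complex.continuous_ofReal.tendsto L).comp hsum)
    (by simpa [Complex.norm_real, Real.norm_eq_abs, sq_abs] using hsq)
    (by filter_upwards [hsmall] with V hV i; simpa [Complex.norm_real] using hV i)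
  have hre := (Complex.continuous_re.tendsto _).comp hC
  rw [Complex.exp_ofReal_re] at hre
  refine hre.congr fun V => ?_
  simp only [Function.comp_apply]
  rw [show (∏ i, (1 + (m V i : ℂ))) = ((∏ i, (1 + m V i) : ℝ) : ℂ) by push_cast; rfl,
    Complex.ofReal_re]

end Products

/-! ## §2 Characteristic function of a heterogeneous row sum -/

section RowCharFun

variable {Y : Type*} {mY : MeasurableSpace Y}

/-- Marginal law of a block statistic under a heterogeneous product law. [ours] -/
theorem heteroPi_map_comp_eval {V : ℕ} (ρ : Fin V → Measure Y) [∀ i, IsProbabilityMeasure (ρ i)]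
    {h : Fin V → Y → ℝ} (hm : ∀ i, Measurable (h i)) (i : Fin V) :
    (Measure.pi ρ).map (fun y : Fin V → Y => h i (y i)) = (ρ i).map (h i) := by
  have hlaw : (Measure.pi ρ).map (Function.eval i) = ρ i := (measurePreserving_eval ρ i).map_eq
  rw [show (fun y : Fin V → Y => h i (y i)) = h i ∘ Function.eval i from rfl,
    ← Measure.map_map (hm i) (measurable_pi_apply i), hlaw]

/-- **The characteristic function of the normalised heterogeneous row sum is the product of the
block characteristic functions.** [ours] -/
theorem heteroPi_charFun_inv_sqrt_mul_sum {V : ℕ} (ρ : Fin V → Measure Y)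
    [∀ i, IsProbabilityMeasure (ρ i)] {h : Fin V → Y → ℝ} (hm : ∀ i, Measurable (h i)) (t : ℝ) :
    charFun ((Measure.pi ρ).map (fun y : Fin V → Y => (Real.sqrt V)⁻¹ * ∑ i, h i (y i))) t
      = ∏ i, charFun ((ρ i).map (h i)) ((Real.sqrt V)⁻¹ * t) := by
  have mX : ∀ i : Fin V, AEMeasurable (fun y : Fin V → Y => h i (y i)) (Measure.pi ρ) :=
    fun i => ((hm i).comp (measurable_pi_apply i)).aemeasurable
  rw [charFun_map_mul_comp (Finset.aemeasurable_fun_sum _ fun i _ => mX i)]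
  have hind : iIndepFun (fun (i : Fin V) (y : Fin V → Y) => h i (y i)) (Measure.pi ρ) :=
    iIndepFun_pi fun i => (hm i).aemeasurable
  rw [hind.charFun_map_fun_sum_eq_prod mX]
  simp only [Finset.prod_apply, heteroPi_map_comp_eval ρ hm]

end RowCharFun

/-! ## §3 The heterogeneous row CLT -/

section HeteroCLT

variable {Y : Type*} {mY : MeasurableSpace Y}
  {ρ : (V : ℕ) → Fin V → Measure Y} [∀ V i, IsProbabilityMeasure (ρ V i)]
  {h : (V : ℕ) → Fin V → Y → ℝ}
variable {Ω' : Type*} {mΩ' : MeasurableSpace Ω'} {P' : Measure Ω'} [IsProbabilityMeasure P']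

/-- **LYAPUNOV'S CLT FOR HETEROGENEOUS ROWS.**  Independent blocks with laws `ρ_{V,i}` and bounded
centred statistics `h_{V,i}` (`|h_{V,i}| ≤ K`), average variance `V⁻¹Σᵢ Var h_{V,i} → σ²`:
`V^{-1/2}Σᵢ h_{V,i}(yᵢ) ⇒ N(0, σ²)`. [ours] -/
theorem heteroPi_tendstoInDistribution (hm : ∀ V i, Measurable (h V i)) {K : ℝ}
    (hK : ∀ V i y, |h V i y| ≤ K) (h0 : ∀ V i, ∫ y, h V i y ∂ρ V i = 0) {σ2 : ℝ}
    (hσ : Tendsto (fun V : ℕ => (∑ i, Var[h V i; ρ V i]) / V) atTop (𝓝 σ2))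
    {Z : Ω' → ℝ} (hZ : HasLaw Z (gaussianReal 0 σ2.toNNReal) P') :
    TendstoInDistribution (fun (V : ℕ) (y : Fin V → Y) => (Real.sqrt V)⁻¹ * ∑ i, h V i (y i)) atTop Z
      (fun V => Measure.pi (ρ V)) P' where
  forall_aemeasurable V := (Finset.aemeasurable_fun_sum _ fun i _ =>
    ((hm V i).comp (measurable_pi_apply i)).aemeasurable).const_mul _
  aemeasurable_limit := hZ.aemeasurable
  tendsto := by
    have hσ0 : 0 ≤ σ2 :=
      ge_of_tendsto' hσ fun V => div_nonneg (Finset.sum_nonneg fun i _ => variance_nonneg _ _)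
        (Nat.cast_nonneg V)
    have hvarK : ∀ V i, Var[h V i; ρ V i] ≤ K ^ 2 := fun V i => by
      have hb : ∀ᵐ y ∂ρ V i, h V i y ∈ Set.Icc (-K) K := ae_of_all _ fun y => abs_le.1 (hK V i y)
      have := variance_le_sq_of_bounded hb (hm V i).aemeasurable
      exact this.trans (le_of_eq (by ring))
    refine ProbabilityMeasure.tendsto_iff_tendsto_charFun.2 fun t => ?_
    simp only [ProbabilityMeasure.coe_mk, heteroPi_charFun_inv_sqrt_mul_sum (ρ _) (hm _), hZ.map_eq,
      charFun_gaussianReal, Complex.ofReal_zero, mul_zero, zero_mul, zero_sub,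
      Real.coe_toNNReal σ2 hσ0]
    -- `zᵢ = φᵢ(t/√V) − 1`
    set z : (V : ℕ) → Fin V → ℂ := fun V i => charFun ((ρ V i).map (h V i)) ((Real.sqrt V)⁻¹ * t) - 1
      with hz
    -- uniform smallness `‖zᵢ + u²σᵢ²/2‖ ≤ |u|³K³`, `u = t/√V`
    have hT : ∀ V i, ‖z V i - ((-(((Real.sqrt V)⁻¹ * t) ^ 2 * Var[h V i; ρ V i] / 2) : ℝ) : ℂ)‖
        ≤ |(Real.sqrt V)⁻¹ * t| ^ 3 * K ^ 3 := fun V i => by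
      have := norm_charFun_map_sub_taylor_le (ρ V i) (hm V i) (hK V i) (h0 V i) ((Real.sqrt V)⁻¹ * t)
      simp only [hz]
      convert this using 2
      push_cast; ring
    -- the bound `εᵥ` on `‖zᵢ‖`
    set ε : ℕ → ℝ := fun V => t ^ 2 * K ^ 2 / (2 * V) + |t| ^ 3 * K ^ 3 / (V * Real.sqrt V) with hε
    have hu2 : ∀ V : ℕ, ((Real.sqrt V)⁻¹ * t) ^ 2 = t ^ 2 / V := fun V => by
      rw [mul_pow, inv_pow, Real.sq_sqrt (Nat.cast_nonneg V)]; ring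
    have hu3 : ∀ V : ℕ, |(Real.sqrt V)⁻¹ * t| ^ 3 = |t| ^ 3 / (V * Real.sqrt V) := fun V => by
      rw [abs_mul, abs_of_nonneg (inv_nonneg.2 (Real.sqrt_nonneg _)), mul_pow, inv_pow]
      have h3 : Real.sqrt V ^ 3 = (V : ℝ) * Real.sqrt V := by
        rw [pow_succ, Real.sq_sqrt (Nat.cast_nonneg V)]
      rw [h3]; ring
    have hzle : ∀ V i, ‖z V i‖ ≤ ε V := fun V i => by
      have h1 := hT V i
      have h2 : ‖((-(((Real.sqrt V)⁻¹ * t) ^ 2 * Var[h V i; ρ V i] / 2) : ℝ) : ℂ)‖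
          ≤ t ^ 2 * K ^ 2 / (2 * V) := by
        rw [Complex.norm_real, Real.norm_eq_abs, abs_neg, hu2,
          abs_of_nonneg (div_nonneg (mul_nonneg (div_nonneg (sq_nonneg t) (Nat.cast_nonneg V))
            (variance_nonneg _ _)) zero_le_two)]
        have := hvarK V i
        calc t ^ 2 / V * Var[h V i; ρ V i] / 2 ≤ t ^ 2 / V * K ^ 2 / 2 := by gcongr
          _ = t ^ 2 * K ^ 2 / (2 * V) := by ring
      calc ‖z V i‖ ≤ ‖z V i - ((-(((Real.sqrt V)⁻¹ * t) ^ 2 * Var[h V i; ρ V i] / 2) : ℝ) : ℂ)‖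
            + ‖((-(((Real.sqrt V)⁻¹ * t) ^ 2 * Var[h V i; ρ V i] / 2) : ℝ) : ℂ)‖ := norm_le_norm_sub_add _ _
        _ ≤ |(Real.sqrt V)⁻¹ * t| ^ 3 * K ^ 3 + t ^ 2 * K ^ 2 / (2 * V) := add_le_add h1 h2
        _ = ε V := by rw [hu3 V]; simp only [hε]; ring
    have hε0 : Tendsto ε atTop (𝓝 0) := by
      have hV : Tendsto (fun V : ℕ => (V : ℝ)) atTop atTop := tendsto_natCast_atTop_atTop
      have hsV : Tendsto (fun V : ℕ => (V : ℝ) * Real.sqrt V) atTop atTop :=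
        hV.atTop_mul_atTop₀ (Real.tendsto_sqrt_atTop.comp hV)
      have a := (tendsto_const_nhds (x := t ^ 2 * K ^ 2)).div_atTop (hV.const_mul_atTop two_pos)
      have b := (tendsto_const_nhds (x := |t| ^ 3 * K ^ 3)).div_atTop hsV
      simpa [hε] using a.add b
    -- Σ zᵢ → −t²σ²/2
    have hsum : Tendsto (fun V => ∑ i, z V i) atTop (𝓝 ((-(σ2 * t ^ 2 / 2) : ℝ) : ℂ)) := by
      have hmain : Tendsto (fun V : ℕ => ((-(t ^ 2 / 2 * ((∑ i, Var[h V i; ρ V i]) / V))) : ℝ))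
          atTop (𝓝 (-(σ2 * t ^ 2 / 2))) := by
        have := (hσ.const_mul (t ^ 2 / 2)).neg
        convert this using 2; ring
      have hmainC := (Complex.continuous_ofReal.tendsto _).comp hmain
      have hrem : Tendsto (fun V : ℕ => ∑ i, z V i
          - (((-(t ^ 2 / 2 * ((∑ i, Var[h V i; ρ V i]) / V))) : ℝ) : ℂ)) atTop (𝓝 0) := by
        rw [tendsto_zero_iff_norm_tendsto_zero]
        have hb : ∀ V : ℕ, ‖∑ i, z V i - (((-(t ^ 2 / 2 * ((∑ i, Var[h V i; ρ V i]) / V))) : ℝ) : ℂ)‖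
            ≤ |t| ^ 3 * K ^ 3 / Real.sqrt V := fun V => by
          have e : (((-(t ^ 2 / 2 * ((∑ i, Var[h V i; ρ V i]) / V))) : ℝ) : ℂ)
              = ∑ i : Fin V, ((-(((Real.sqrt V)⁻¹ * t) ^ 2 * Var[h V i; ρ V i] / 2) : ℝ) : ℂ) := by
            rw [← Complex.ofReal_sum]; congr 1
            rw [hu2, Finset.sum_div, Finset.mul_sum, ← Finset.sum_neg_distrib]
            exact Finset.sum_congr rfl fun i _ => by ring
          rw [e, ← Finset.sum_sub_distrib]
          refine (norm_sum_le _ _).trans ?_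
          calc ∑ i, ‖z V i - ((-(((Real.sqrt V)⁻¹ * t) ^ 2 * Var[h V i; ρ V i] / 2) : ℝ) : ℂ)‖
              ≤ ∑ _i : Fin V, |(Real.sqrt V)⁻¹ * t| ^ 3 * K ^ 3 := Finset.sum_le_sum fun i _ => hT V i
            _ = V * (|t| ^ 3 * K ^ 3 / (V * Real.sqrt V)) := by
                rw [Finset.sum_const, Finset.card_univ, Fintype.card_fin, nsmul_eq_mul, hu3 V]; ring
            _ ≤ |t| ^ 3 * K ^ 3 / Real.sqrt V := by
                rcases Nat.eq_zero_or_pos V with hV | hV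
                · subst hV; simp
                · have hV' : (0 : ℝ) < V := Nat.cast_pos.2 hV
                  have hsV : 0 < Real.sqrt V := Real.sqrt_pos.2 hV'
                  apply le_of_eq
                  field_simp
        have hup : Tendsto (fun V : ℕ => |t| ^ 3 * K ^ 3 / Real.sqrt V) atTop (𝓝 0) := by
          have := (tendsto_inv_atTop_zero.comp
            (Real.tendsto_sqrt_atTop.comp tendsto_natCast_atTop_atTop)).const_mul (|t| ^ 3 * K ^ 3)
          simpa [div_eq_mul_inv] using this
        exact squeeze_zero (fun V => norm_nonneg _) hb hup
      have := hmainC.add hrem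
      simpa using this
    -- Σ ‖zᵢ‖² ≤ V ε² → 0
    have hsq : Tendsto (fun V => ∑ i, ‖z V i‖ ^ 2) atTop (𝓝 0) := by
      have hb : ∀ V : ℕ, ∑ i, ‖z V i‖ ^ 2 ≤ V * ε V ^ 2 := fun V => by
        calc ∑ i, ‖z V i‖ ^ 2 ≤ ∑ _i : Fin V, ε V ^ 2 :=
              Finset.sum_le_sum fun i _ => pow_le_pow_left₀ (norm_nonneg _) (hzle V i) 2
          _ = V * ε V ^ 2 := by simp
      have hVε : Tendsto (fun V : ℕ => (V : ℝ) * ε V ^ 2) atTop (𝓝 0) := by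
        -- `V ε² = (t²K²/2 + |t|³K³/√V)² / V`
        have e : ∀ V : ℕ, 0 < V → (V : ℝ) * ε V ^ 2
            = (t ^ 2 * K ^ 2 / 2 + |t| ^ 3 * K ^ 3 / Real.sqrt V) ^ 2 / V := fun V hV => by
          have hV' : (0 : ℝ) < V := Nat.cast_pos.2 hV
          have hsV : 0 < Real.sqrt V := Real.sqrt_pos.2 hV'
          simp only [hε]
          field_simp
        have hlim : Tendsto (fun V : ℕ => (t ^ 2 * K ^ 2 / 2 + |t| ^ 3 * K ^ 3 / Real.sqrt V) ^ 2 / V)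
            atTop (𝓝 0) := by
          have hc : Tendsto (fun V : ℕ => t ^ 2 * K ^ 2 / 2 + |t| ^ 3 * K ^ 3 / Real.sqrt V) atTop
              (𝓝 (t ^ 2 * K ^ 2 / 2 + 0)) := by
            refine tendsto_const_nhds.add ?_
            have := (tendsto_inv_atTop_zero.comp
              (Real.tendsto_sqrt_atTop.comp tendsto_natCast_atTop_atTop)).const_mul (|t| ^ 3 * K ^ 3)
            simpa [div_eq_mul_inv] using this
          exact (hc.pow 2).div_atTop tendsto_natCast_atTop_atTop
        refine (hlim.congr' ?_)
        filter_upwards [eventually_gt_atTop 0] with V hV using (e V hV).symm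
      exact squeeze_zero (fun V => Finset.sum_nonneg fun i _ => sq_nonneg _) hb hVε
    have hsmall : ∀ᶠ V in atTop, ∀ i : Fin V, ‖z V i‖ ≤ 1 / 2 := by
      filter_upwards [(Metric.tendsto_nhds.1 hε0) (1 / 2) (by norm_num)] with V hV i
      have : |ε V| < 1 / 2 := by simpa [Real.dist_eq] using hV
      exact (hzle V i).trans (le_of_lt (lt_of_abs_lt this))
    have key := tendsto_finprod_one_add_cexp hsum hsq hsmall
    have e : ∀ V : ℕ, ∏ i, (1 + z V i) = ∏ i, charFun ((ρ V i).map (h V i)) ((Real.sqrt V)⁻¹ * t) :=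
      fun V => Finset.prod_congr rfl fun i _ => by simp [hz]
    simp_rw [e] at key
    convert key using 2
    push_cast
    ring

end HeteroCLT

end Summit.Ventures.LatticeQCDFlow.Theory2

end
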